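import Summits.AnomalousDissipation.AnomalousDissipation.Theorems.SawtoothPulseCascadeK1LocalisedCascadeKHSheetPropagator
import Mathlib.MeasureTheory.Integral.IntervalIntegral.FundThmCalculus
import Mathlib.Tactic.Module

/-!
# K2 lane (route-2 `SawtoothPulseCascade`, crux dir `K1LocalisedCascade`): DUHAMEL FORMULA for the forced Kelvin–Helmholtz sheet block

Helper file of the K2 lane (S2-cert = one-slot forced kink-sheet response, arbiter A25-11′; planner p4's `K2ControlNorm.md` §2(c)/(d),
WO1 §1: `q′ = X q + f[interior]`; ACL item stmt-AnomalousDissipation-19491). For the block `F` (p4's `khField`, written out, named by `hF`),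
a propagator pair `(C, Sn)` (`C′ = −k²c²·Sn`, `Sn′ = C`, `C 0 = 1`, `Sn 0 = 0`, `C² + Sn²k²c² = 1` — the three pairs of
`…KHSheetReduction`), and a CONTINUOUS forcing `g`, every `q` with `HasDerivWithinAt q (F (q θ) + g θ) (Icc 0 γ) θ` on `[0, γ]` is

  `q θ = C θ • (q 0 + a θ) + Sn θ • F (q 0 + a θ)`,  `a θ = ∫₀^θ (C s • g s − Sn s • F (g s)) ds`

(`sheet_forced_solution_eq`): variation of constants with `P(θ)P(−θ) = Id` (unit determinant), `P(−s) = C s·Id − Sn s·F`. With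
`khForm_propagated_le_trace` this makes the forced single-mode responses of the sheet block explicit scalar integrals. No definitions;
no statement about the crux. [cite: Drazin2002, §8.3 (8.36)–(8.38) (Rayleigh jump conditions at the kinks of a broken-line profile)] [problem: turb]
-/

-- `Summit.<Summit>.<Problem>`: single-conjunct summit, the duplicate namespace segment is deliberate.
set_option linter.dupNamespace false

noncomputable section

namespace Summit.AnomalousDissipation.AnomalousDissipation.Theorems.SawtoothPulseCascade.K2PhaseBudget

open Set Real Complex MeasureTheory intervalIntegral Literature.Analysis.FluidPDE.SawtoothCascade

/-- The sheet block as a continuous ℂ-linear map (for derivatives through `F`). [folklore] -/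
theorem sheetBlock_exists_clm {k : ℝ} {p S : ℂ} {F : (Fin 2 → ℂ) → (Fin 2 → ℂ)}
    (hF : F = fun v => ![I * k * (-p * v 0 - 2 * S * v 1), I * k * (2 * (starRingEnd ℂ) S * v 0 + p * v 1)]) :
    ∃ L : (Fin 2 → ℂ) →L[ℂ] (Fin 2 → ℂ), (L : (Fin 2 → ℂ) → (Fin 2 → ℂ)) = F := by
  let L : (Fin 2 → ℂ) →ₗ[ℂ] (Fin 2 → ℂ) :=
    { toFun := F
      map_add' := fun v w => by
        have := sheetBlock_linear hF 1 1 v w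
        simpa using this
      map_smul' := fun a v => by
        have := sheetBlock_linear hF a 0 v v
        simpa using this }
  exact ⟨LinearMap.toContinuousLinearMap L, rfl⟩

/-- **Duhamel formula for the forced sheet block.** [cite: Drazin2002, §8.3 (8.36)–(8.38)] -/
theorem sheet_forced_solution_eq {k β γ : ℝ} {p S : ℂ} {F : (Fin 2 → ℂ) → (Fin 2 → ℂ)}
    (hp : p = ((π / 2 + 2 * sawSigma0 k β : ℝ) : ℂ)) (hS : S = sawS k β)
    (hF : F = fun v => ![I * k * (-p * v 0 - 2 * S * v 1), I * k * (2 * (starRingEnd ℂ) S * v 0 + p * v 1)])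
    {C Sn : ℝ → ℝ} (hC : ∀ θ, HasDerivAt C (-(k ^ 2 * sawC2 k β) * Sn θ) θ) (hSn : ∀ θ, HasDerivAt Sn (C θ) θ)
    (hC0 : C 0 = 1) (hSn0 : Sn 0 = 0) (hdet : ∀ θ, C θ ^ 2 + Sn θ ^ 2 * k ^ 2 * sawC2 k β = 1)
    {g : ℝ → (Fin 2 → ℂ)} (hg : Continuous g)
    {q : ℝ → (Fin 2 → ℂ)} (hq : ∀ θ ∈ Icc (0 : ℝ) γ, HasDerivWithinAt q (F (q θ) + g θ) (Icc (0 : ℝ) γ) θ) :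
    ∀ θ ∈ Icc (0 : ℝ) γ,
      q θ = ((C θ : ℝ) : ℂ) • (q 0 + ∫ s in (0 : ℝ)..θ, (((C s : ℝ) : ℂ) • g s - ((Sn s : ℝ) : ℂ) • F (g s))) +
        ((Sn θ : ℝ) : ℂ) • F (q 0 + ∫ s in (0 : ℝ)..θ, (((C s : ℝ) : ℂ) • g s - ((Sn s : ℝ) : ℂ) • F (g s))) := by
  obtain ⟨L, hL⟩ := sheetBlock_exists_clm hF
  obtain ⟨K, hK⟩ := sheetBlock_lipschitz hF
  have hFc : Continuous F := by rw [← hL]; exact L.continuous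
  have hCc : Continuous C := continuous_iff_continuousAt.2 fun θ => (hC θ).continuousAt
  have hSnc : Continuous Sn := continuous_iff_continuousAt.2 fun θ => (hSn θ).continuousAt
  -- the Duhamel integrand and its primitive
  set h : ℝ → (Fin 2 → ℂ) := fun s => ((C s : ℝ) : ℂ) • g s - ((Sn s : ℝ) : ℂ) • F (g s) with hh_def
  have hhc : Continuous h := by
    apply Continuous.sub
    · exact (Complex.continuous_ofReal.comp hCc).smul hg
    · exact (Complex.continuous_ofReal.comp hSnc).smul (hFc.comp hg)
  set a : ℝ → (Fin 2 → ℂ) := fun θ => ∫ s in (0 : ℝ)..θ, h s with ha_def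
  have ha : ∀ θ, HasDerivAt a (h θ) θ := fun θ => (hhc.integral_hasStrictDerivAt 0 θ).hasDerivAt
  have ha0 : a 0 = 0 := by simp [ha_def]
  -- the candidate solution `r θ = C θ • w θ + Sn θ • F (w θ)`, `w = q 0 + a`
  set v := q 0 with hv
  set w : ℝ → (Fin 2 → ℂ) := fun θ => v + a θ with hw_def
  have hw : ∀ θ, HasDerivAt w (h θ) θ := fun θ => by
    simpa [hw_def] using (ha θ).const_add v
  set r : ℝ → (Fin 2 → ℂ) := fun θ => ((C θ : ℝ) : ℂ) • w θ + ((Sn θ : ℝ) : ℂ) • F (w θ) with hr_def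
  have hFw : ∀ θ, HasDerivAt (fun t => F (w t)) (F (h θ)) θ := by
    intro θ
    have key := ((L.restrictScalars ℝ).hasFDerivAt (x := w θ)).comp_hasDerivAt θ (hw θ)
    have e1 : (⇑(L.restrictScalars ℝ) ∘ w) = fun t => F (w t) := by
      funext t; simp [hL]
    have e2 : (L.restrictScalars ℝ) (h θ) = F (h θ) := by simp [hL]
    rw [e1, e2] at key
    exact key
  have hr : ∀ θ, HasDerivAt r (F (r θ) + g θ) θ := by
    intro θ
    have h1 : HasDerivAt (fun t => ((C t : ℝ) : ℂ) • w t)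
        (((C θ : ℝ) : ℂ) • h θ + (((-(k ^ 2 * sawC2 k β) * Sn θ : ℝ)) : ℂ) • w θ) θ :=
      ((hC θ).ofReal_comp).smul (hw θ)
    have h2 : HasDerivAt (fun t => ((Sn t : ℝ) : ℂ) • F (w t))
        (((Sn θ : ℝ) : ℂ) • F (h θ) + ((C θ : ℝ) : ℂ) • F (w θ)) θ :=
      ((hSn θ).ofReal_comp).smul (hFw θ)
    refine (h1.add h2).congr_deriv ?_
    -- algebra: `F (F x) = λ • x`, `F` linear, `C² + Sn² k² c² = 1`
    have hlin := sheetBlock_linear hF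
    have hsq := sheetBlock_sq hp hS hF
    have hFh : F (h θ) = ((C θ : ℝ) : ℂ) • F (g θ) - ((Sn θ : ℝ) : ℂ) • ((-(((k ^ 2 * sawC2 k β : ℝ) : ℂ))) • g θ) := by
      rw [hh_def]
      simp only []
      rw [sub_eq_add_neg, ← neg_smul, hlin, hsq, neg_smul, ← sub_eq_add_neg]
    have hFr : F (r θ) = ((C θ : ℝ) : ℂ) • F (w θ) + ((Sn θ : ℝ) : ℂ) • ((-(((k ^ 2 * sawC2 k β : ℝ) : ℂ))) • w θ) := by
      rw [hr_def]
      simp only []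
      rw [hlin, hsq]
    have hdetC : ((C θ : ℝ) : ℂ) ^ 2 + ((Sn θ : ℝ) : ℂ) ^ 2 * (k : ℂ) ^ 2 * ((sawC2 k β : ℝ) : ℂ) = 1 := by
      have := hdet θ
      exact_mod_cast this
    have hhθ : h θ = ((C θ : ℝ) : ℂ) • g θ - ((Sn θ : ℝ) : ℂ) • F (g θ) := rfl
    have hg' : g θ = (((C θ : ℝ) : ℂ) ^ 2 + ((Sn θ : ℝ) : ℂ) ^ 2 * (k : ℂ) ^ 2 * ((sawC2 k β : ℝ) : ℂ)) • g θ := by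
      rw [hdetC, one_smul]
    rw [hFr, hFh, hhθ]
    conv_rhs => rw [hg']
    push_cast
    module
  -- uniqueness on `[0, γ]`
  have hqc : ContinuousOn q (Icc 0 γ) := fun t ht => (hq t ht).continuousWithinAt
  have hq' : ∀ t ∈ Ico (0 : ℝ) γ, HasDerivWithinAt q (F (q t) + g t) (Ici t) t := by
    intro t ht
    have h := hq t ⟨ht.1, ht.2.le⟩
    apply h.mono_of_mem_nhdsWithin
    exact Filter.mem_of_superset (Icc_mem_nhdsGE ht.2) (Icc_subset_Icc ht.1 le_rfl)
  have hrc : ContinuousOn r (Icc 0 γ) := fun t _ => (hr t).continuousAt.continuousWithinAt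
  have hr' : ∀ t ∈ Ico (0 : ℝ) γ, HasDerivWithinAt r (F (r t) + g t) (Ici t) t :=
    fun t _ => (hr t).hasDerivWithinAt
  have h0 : q 0 = r 0 := by
    simp [hr_def, hw_def, ha0, hC0, hSn0, hv]
  have hKt : ∀ t : ℝ, LipschitzWith K (fun x : Fin 2 → ℂ => F x + g t) := by
    intro t x y
    simp only [edist_add_right]
    exact hK x y
  have heq := ODE_solution_unique (v := fun t x => F x + g t) hKt hqc hq' hrc hr' h0
  intro θ hθ
  exact heq hθ

end Summit.AnomalousDissipation.AnomalousDissipation.Theorems.SawtoothPulseCascade.K2PhaseBudget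

end
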